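import Summits.QuantumAdvantage.AdviceFreeQNC0.WindowBells
import Summits.QuantumAdvantage.AdviceFreeQNC0.GlobalJuntaGap
import HarnessLib

/-!
# Cell qa-qnc0 — the WINDOW GAP LAW with loss `1/3 − O(2^{−m/42})`, EVERY charge (degree-free, adaptive)
(planner qa-qnc0-p2 g17 `line17/Sketch17.lean` §5: "the tree has only `GapLaw m 1 4`"; conjecture `WindowGapSharp`: loss → 1/3)

**`gapLaw_window (ℓ₀ ≥ 1) : GapLaw (42·ℓ₀) (2^{ℓ₀} − 2) (3·2^{ℓ₀})`** — a walk strategy (any charge `c`, any selectors, any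
degree) that does not READ `42ℓ₀` consecutive input bits wins on at most `(2/3)(1 + 2^{−ℓ₀})·2ⁿ` inputs; cuts inside the window
may fire.  The loss tends to the sharp `1/3` (the end bet wins `2/3`).

This is `WindowBells.window_le` (charge `n + 2`, the ring's) for an arbitrary charge: the sparse branch (`sparse_block_le`) was
already charge-free; the dense branch is redone here from `ConstBells.sgnU_eq_sum` (charge `c`, end-state sum built in):
`fibre_sgnU_eq` (fibre path sum), `three_mul_card_win_fibre_dense_le'`, `dense_block_le'`, `window_le'`.

WHAT THIS IS NOT: not the conjectured sharp constants `WindowGapSharp` (window `m` instead of `42ℓ₀`); crux 22907 / 23029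
untouched; separation NOT moved.
-/

noncomputable section

namespace Summit.QuantumAdvantage.AdviceFreeQNC0

namespace TransferWalk

open Finset Literature.Computability.QuantumComplexity Literature.Computability.MetaComplexity ConstBells

variable {p ℓ q : ℕ}

/-! ## The fibre path sum at charge `c` -/

/-- `st = posZ`. -/
theorem st_eq_posZ' {n : ℕ} (u : Fin n → Bool) (j : ℕ) : st u j = posZ u j := rfl

/-- Prefix factor at charge `c` (cuts `< p`). -/
def preT (BN : Finset ℕ) (n : ℕ) (κ τ : ZMod 3) (a : Fin p → Bool) : ℝ := ∏ g ∈ range p, fT BN n κ τ g (posZ a g)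

/-- Suffix vector at charge `c` (cuts `≥ p + ℓ`, end-state indicator included in `fT` at cut `n`). -/
def sufT (BN : Finset ℕ) (n : ℕ) (κ τ : ZMod 3) (p ℓ : ℕ) (b : Fin q → Bool) : ZMod 3 → ℝ := fun d =>
  ∏ i ∈ range (q + 1), fT BN n κ τ (p + ℓ + i) (d - (κ + τ) + posZ b i)

/-- `preT² ≤ 1`. -/
theorem preT_sq_le (BN : Finset ℕ) (n : ℕ) (κ τ : ZMod 3) (a : Fin p → Bool) : preT BN n κ τ a ^ 2 ≤ 1 := by
  unfold preT; rw [← Finset.prod_pow]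
  exact Finset.prod_le_one (fun g _ => by positivity) fun g _ => fT_sq_le BN n κ τ _ _

/-- `nsq sufT ≤ 3`. -/
theorem nsq_sufT_le (BN : Finset ℕ) (n : ℕ) (κ τ : ZMod 3) (p ℓ : ℕ) (b : Fin q → Bool) :
    nsq (sufT BN n κ τ p ℓ b) ≤ 3 := by
  have h : ∀ d : ZMod 3, sufT BN n κ τ p ℓ b d ^ 2 ≤ 1 := by
    intro d; unfold sufT; rw [← Finset.prod_pow]
    exact Finset.prod_le_one (fun g _ => by positivity) fun g _ => fT_sq_le BN n κ τ _ _
  unfold nsq; linarith [h 0, h 1, h 2]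

/-- Inside the window (cut `p + g < n`) the constant-strategy factor is the bell factor of `pathSum`. -/
theorem fT_window_eq (B : Finset (Fin (p + ℓ + q + 1))) (κ τ : ZMod 3) {g : ℕ} (hg : g < ℓ) (s : ZMod 3) :
    fT (bellsN B) (p + ℓ + q) κ τ (p + g) s =
      bfz (fun k => decide (k ∈ B.map Fin.valEmbedding)) (p + g) (κ + τ + s) := by
  unfold fT bellsN
  rw [if_neg (by omega : p + g ≠ p + ℓ + q), mul_one]
  unfold bfz
  have hiff : ((fun k => decide (k ∈ B.map Fin.valEmbedding)) (p + g) = true) ↔ (p + g ∈ B.map Fin.valEmbedding) := by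
    simp
  by_cases hb : p + g ∈ B.map Fin.valEmbedding
  · rw [if_pos hb, if_pos (hiff.2 hb)]
    unfold sig fz
    rw [show κ + s + τ = κ + τ + s by ring]
  · rw [if_neg hb, if_neg (fun h => hb (hiff.1 h))]

/-- **Fibre path sum at charge `c`**: `Σ_v sgnU_c(a ++ v ++ b) = Σ_τ preT_τ(a) · 2^ℓ · (seg_window sufT_τ)(κ + τ + pos_p a)`. -/
theorem fibre_sgnU_eq (c : ℕ) (B : Finset (Fin (p + ℓ + q + 1))) (a : Fin p → Bool) (b : Fin q → Bool) :
    ∑ v : Fin ℓ → Bool, sgnU c B (glue3 a v b) =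
      ∑ τ : ZMod 3, preT (bellsN B) (p + ℓ + q) (((c + 2 * (p + ℓ + q) : ℕ) : ZMod 3)) τ a *
        (2 ^ ℓ * seg (fun k => decide (k ∈ B.map Fin.valEmbedding)) p ℓ
          (sufT (bellsN B) (p + ℓ + q) (((c + 2 * (p + ℓ + q) : ℕ) : ZMod 3)) τ p ℓ b)
          ((((c + 2 * (p + ℓ + q) : ℕ) : ZMod 3)) + τ + posZ a p)) := by
  set κ : ZMod 3 := ((c + 2 * (p + ℓ + q) : ℕ) : ZMod 3) with hκ
  set bell : ℕ → Bool := fun k => decide (k ∈ B.map Fin.valEmbedding) with hbell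
  set S : ZMod 3 := posZ a p with hS
  have hterm : ∀ (v : Fin ℓ → Bool) (τ : ZMod 3),
      (∏ j ∈ range (p + ℓ + q + 1), fT (bellsN B) (p + ℓ + q) κ τ j (st (glue3 a v b) j)) =
      preT (bellsN B) (p + ℓ + q) κ τ a * ((∏ g ∈ range ℓ, bfz bell (p + g) ((κ + τ + S) + posZ v g)) *
        sufT (bellsN B) (p + ℓ + q) κ τ p ℓ b ((κ + τ + S) + posZ v ℓ)) := by
    intro v τ
    rw [show p + ℓ + q + 1 = p + (ℓ + (q + 1)) by ring, Finset.prod_range_add, Finset.prod_range_add]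
    unfold preT sufT
    congr 1
    · exact Finset.prod_congr rfl fun g hg => by rw [st_eq_posZ', posZ_glue3_of_le a v b (mem_range.1 hg).le]
    · congr 1
      · refine Finset.prod_congr rfl fun g hg => ?_
        rw [st_eq_posZ', posZ_glue3_mid a v b (mem_range.1 hg).le, fT_window_eq B κ τ (mem_range.1 hg),
          show κ + τ + (S + posZ v g) = κ + τ + S + posZ v g by ring]
      · refine Finset.prod_congr rfl fun i _ => ?_
        rw [st_eq_posZ', show p + (ℓ + i) = p + ℓ + i by ring, posZ_glue3_of_ge a v b i,
          show κ + τ + S + posZ v ℓ - (κ + τ) + posZ b i = S + posZ v ℓ + posZ b i by ring]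
  have hsgn : ∀ v : Fin ℓ → Bool, sgnU c B (glue3 a v b) =
      ∑ τ : ZMod 3, preT (bellsN B) (p + ℓ + q) κ τ a * ((∏ g ∈ range ℓ, bfz bell (p + g) ((κ + τ + S) + posZ v g)) *
        sufT (bellsN B) (p + ℓ + q) κ τ p ℓ b ((κ + τ + S) + posZ v ℓ)) := by
    intro v
    rw [sgnU_eq_sum]
    exact Finset.sum_congr rfl fun τ _ => hterm v τ
  simp_rw [hsgn]
  rw [Finset.sum_comm]
  refine Finset.sum_congr rfl fun τ _ => ?_
  rw [← Finset.mul_sum, pathSum bell ℓ p (κ + τ + S) (sufT (bellsN B) (p + ℓ + q) κ τ p ℓ b)]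

/-! ## Dense fibres at charge `c` -/

/-- **Dense fibre, any charge** (constant bells): `≥ 42` bells at the cuts `[p, p+ℓ)` ⇒ `3·#{v : WIN} ≤ 2·2^ℓ`. -/
theorem three_mul_card_win_fibre_dense_const_le' (c : ℕ) (B : Finset (Fin (p + ℓ + q + 1))) (a : Fin p → Bool)
    (b : Fin q → Bool) (hB : 42 ≤ (B.filter fun g => p ≤ g.val ∧ g.val < p + ℓ).card) :
    3 * ((univ.filter fun v : Fin ℓ → Bool => ringWinU c (constY B) (glue3 a v b) = true).card : ℝ) ≤ 2 * (2 : ℝ) ^ ℓ := by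
  classical
  set κ : ZMod 3 := ((c + 2 * (p + ℓ + q) : ℕ) : ZMod 3) with hκ
  set bell : ℕ → Bool := fun g => decide (g ∈ B.map Fin.valEmbedding) with hbell
  -- sorted bells inside the window (as in `three_mul_card_win_fibre_dense_const_le`)
  set Bw : Finset ℕ := (B.filter fun g => p ≤ g.val ∧ g.val < p + ℓ).map Fin.valEmbedding with hBw
  have hcard : 42 ≤ Bw.card := by rw [hBw, Finset.card_map]; exact hB
  have hBw_mem : ∀ {g : ℕ}, g ∈ Bw ↔ g ∈ B.map Fin.valEmbedding ∧ p ≤ g ∧ g < p + ℓ := by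
    intro g
    simp only [hBw, Finset.mem_map, Finset.mem_filter, Fin.valEmbedding_apply]
    constructor
    · rintro ⟨k, ⟨hk, h1, h2⟩, rfl⟩; exact ⟨⟨k, hk, rfl⟩, h1, h2⟩
    · rintro ⟨⟨k, hk, rfl⟩, h1, h2⟩; exact ⟨k, ⟨hk, h1, h2⟩, rfl⟩
  set e := Bw.orderEmbOfFin (rfl : Bw.card = Bw.card) with he
  set K : ℕ → ℕ := fun j => if h : j < Bw.card then e ⟨j, h⟩ else 0 with hK
  have hKe : ∀ j (h : j < Bw.card), K j = e ⟨j, h⟩ := fun j h => by simp only [hK, dif_pos h]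
  have hKmem : ∀ j, j < Bw.card → K j ∈ Bw := fun j h => by rw [hKe j h]; exact Finset.orderEmbOfFin_mem _ _ _
  have hKmono : ∀ i j, i < j → j ≤ 41 → K i < K j := by
    intro i j hij hj
    rw [hKe i (by omega), hKe j (by omega)]
    exact e.strictMono (Fin.mk_lt_mk.2 hij)
  have hKbell : ∀ j, j ≤ 41 → bell (K j) = true := fun j hj => by
    simp only [hbell, decide_eq_true_eq]; exact (hBw_mem.1 (hKmem j (by omega))).1
  have hKgap : ∀ j g, j < 41 → K j < g → g < K (j + 1) → bell g = false := by
    intro j g hj h1 h2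
    simp only [hbell, decide_eq_false_iff_not]
    intro hg
    have hgw : g ∈ Bw := by
      refine hBw_mem.2 ⟨hg, ?_, ?_⟩
      · exact le_trans (hBw_mem.1 (hKmem j (by omega))).2.1 h1.le
      · exact lt_trans h2 (hBw_mem.1 (hKmem (j + 1) (by omega))).2.2
    have hr : g ∈ Set.range e := by rw [Finset.range_orderEmbOfFin]; exact hgw
    obtain ⟨i, hi⟩ := hr
    rw [hKe j (by omega), ← hi] at h1
    rw [hKe (j + 1) (by omega), ← hi] at h2
    have h1' := e.strictMono.lt_iff_lt.1 h1
    have h2' := e.strictMono.lt_iff_lt.1 h2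
    rw [Fin.lt_def] at h1' h2'
    simp only at h1' h2'
    omega
  have hK0 : p ≤ K 0 := (hBw_mem.1 (hKmem 0 (by omega))).2.1
  have hK41 : K 41 ≤ p + ℓ := (hBw_mem.1 (hKmem 41 (by omega))).2.2.le
  -- signed count
  set W := (univ.filter fun v : Fin ℓ → Bool => ringWinU c (constY B) (glue3 a v b) = true) with hW
  have hcount : ∑ v : Fin ℓ → Bool, sgnU c B (glue3 a v b) = (2 : ℝ) ^ ℓ - 2 * (W.card : ℝ) := by
    have h1 : ∀ v : Fin ℓ → Bool, sgnU c B (glue3 a v b) =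
        1 - 2 * (if ringWinU c (constY B) (glue3 a v b) = true then (1 : ℝ) else 0) := by
      intro v; unfold sgnU; split_ifs <;> norm_num
    simp only [h1]
    rw [Finset.sum_sub_distrib, ← Finset.mul_sum, sum_const, card_univ, Fintype.card_fun, Fintype.card_bool,
      Fintype.card_fin, nsmul_eq_mul, mul_one, hW, natCast_card_filter]
    push_cast; ring
  have hpath := fibre_sgnU_eq c B a b
  have hterm : ∀ τ : ZMod 3, |preT (bellsN B) (p + ℓ + q) κ τ a *
      (2 ^ ℓ * seg bell p ℓ (sufT (bellsN B) (p + ℓ + q) κ τ p ℓ b) (κ + τ + posZ a p))| ≤ (2 : ℝ) ^ ℓ * (1 / 60) := by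
    intro τ
    have h1' : (preT (bellsN B) (p + ℓ + q) κ τ a) ^ 2 ≤ (1 : ℝ) ^ 2 := by rw [one_pow]; exact preT_sq_le _ _ _ _ a
    have ha : |preT (bellsN B) (p + ℓ + q) κ τ a| ≤ 1 := abs_le_of_sq_le_sq h1' zero_le_one
    have h2 : (seg bell p ℓ (sufT (bellsN B) (p + ℓ + q) κ τ p ℓ b) (κ + τ + posZ a p)) ^ 2 ≤ (5 / 8 : ℝ) ^ 20 * 3 :=
      (sq_le_nsq _ _).trans ((nsq_seg_window_le bell K hKmono hKbell hKgap hK0 hK41 _).trans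
        (mul_le_mul_of_nonneg_left (nsq_sufT_le _ _ _ _ p ℓ b) (by positivity)))
    have h3 : (5 / 8 : ℝ) ^ 20 * 3 ≤ (1 / 60 : ℝ) ^ 2 := by norm_num
    have hb : |seg bell p ℓ (sufT (bellsN B) (p + ℓ + q) κ τ p ℓ b) (κ + τ + posZ a p)| ≤ 1 / 60 :=
      abs_le_of_sq_le_sq (h2.trans h3) (by norm_num)
    rw [abs_mul, abs_mul, abs_of_pos (by positivity : (0 : ℝ) < 2 ^ ℓ)]
    have h4 : (0 : ℝ) ≤ 2 ^ ℓ := by positivity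
    calc |preT (bellsN B) (p + ℓ + q) κ τ a| * (2 ^ ℓ * |seg bell p ℓ (sufT (bellsN B) (p + ℓ + q) κ τ p ℓ b) (κ + τ + posZ a p)|)
        ≤ 1 * (2 ^ ℓ * (1 / 60)) := mul_le_mul ha (mul_le_mul_of_nonneg_left hb h4) (by positivity) zero_le_one
      _ = (2 : ℝ) ^ ℓ * (1 / 60) := one_mul _
  have hsum : |∑ τ : ZMod 3, preT (bellsN B) (p + ℓ + q) κ τ a *
      (2 ^ ℓ * seg bell p ℓ (sufT (bellsN B) (p + ℓ + q) κ τ p ℓ b) (κ + τ + posZ a p))| ≤ 3 * ((2 : ℝ) ^ ℓ * (1 / 60)) := by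
    refine (Finset.abs_sum_le_sum_abs _ _).trans ((Finset.sum_le_sum fun τ _ => hterm τ).trans ?_)
    rw [sum_const, card_univ, ZMod.card]; simp
  rw [← hpath, hcount] at hsum
  have := (abs_le.1 hsum).1
  nlinarith

/-- **Dense fibre, any charge** (adaptive selector not reading the window on this fibre). -/
theorem three_mul_card_win_fibre_dense_le' (c : ℕ) (y : Fin (p + ℓ + q + 1) → (Fin (p + ℓ + q) → Bool) → Bool)
    (a : Fin p → Bool) (b : Fin q → Bool)
    (hy : ∀ (v v' : Fin ℓ → Bool) (g : Fin (p + ℓ + q + 1)), y g (glue3 a v b) = y g (glue3 a v' b))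
    (hdense : 42 ≤ (univ.filter fun g : Fin (p + ℓ + q + 1) =>
      p ≤ g.val ∧ g.val < p + ℓ ∧ y g (glue3 a (fun _ => false) b) = true).card) :
    3 * ((univ.filter fun v : Fin ℓ → Bool => ringWinU c y (glue3 a v b) = true).card : ℝ) ≤ 2 * (2 : ℝ) ^ ℓ := by
  classical
  set B : Finset (Fin (p + ℓ + q + 1)) := univ.filter fun g => y g (glue3 a (fun _ => false) b) = true with hB
  have heq : (univ.filter fun v : Fin ℓ → Bool => ringWinU c y (glue3 a v b) = true) =
      univ.filter fun v : Fin ℓ → Bool => ringWinU c (constY B) (glue3 a v b) = true := by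
    refine filter_congr fun v _ => ?_
    rw [LinForms.ringWinU_congr c (y := y) (y' := constY B)
      (fun g => by simp only [constY, hB, mem_filter, mem_univ, true_and, Bool.decide_eq_true]; exact hy v _ g)]
  rw [heq]
  refine three_mul_card_win_fibre_dense_const_le' c B a b (le_trans hdense (le_of_eq ?_))
  congr 1
  ext g
  simp only [hB, mem_filter, mem_univ, true_and]
  tauto

/-- **Dense block, any charge** (u-level). -/
theorem dense_block_le' (n c p ℓ : ℕ) (hpl : p + ℓ ≤ n) (y : Fin (n + 1) → (Fin n → Bool) → Bool)
    (P : (Fin n → Bool) → Prop) [DecidablePred P]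
    (hP : ∀ u u', AgreeOff n p ℓ u u' → P u → P u')
    (hy : ∀ u u', AgreeOff n p ℓ u u' → ∀ g, y g u = y g u')
    (hdense : ∀ u, P u → 42 ≤ (univ.filter fun g : Fin (n + 1) => p ≤ g.val ∧ g.val < p + ℓ ∧ y g u = true).card) :
    3 * ((univ.filter fun u : Fin n → Bool => P u ∧ ringWinU c y u = true).card : ℝ) ≤
      2 * ((univ.filter fun u : Fin n → Bool => P u).card : ℝ) := by
  obtain ⟨q, rfl⟩ : ∃ q, n = p + ℓ + q := ⟨n - (p + ℓ), by omega⟩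
  rw [card_filter_eq_sum_glue3 (fun u => P u ∧ ringWinU c y u = true), card_filter_eq_sum_glue3 (fun u => P u)]
  push_cast
  simp only [Finset.mul_sum]
  refine Finset.sum_le_sum fun a _ => Finset.sum_le_sum fun b _ => ?_
  by_cases hPab : P (glue3 a (fun _ => false) b)
  · have hall : ∀ v, P (glue3 a v b) := fun v => hP _ _ (glue3_agreeOff a _ v b) hPab
    have h1 : (univ.filter fun v : Fin ℓ → Bool => P (glue3 a v b) ∧ ringWinU c y (glue3 a v b) = true) =
        univ.filter fun v : Fin ℓ → Bool => ringWinU c y (glue3 a v b) = true :=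
      filter_congr fun v _ => by simp [hall v]
    have h2 : (univ.filter fun v : Fin ℓ → Bool => P (glue3 a v b)).card = 2 ^ ℓ := by
      rw [Finset.filter_true_of_mem fun v _ => hall v, card_univ, Fintype.card_fun, Fintype.card_bool, Fintype.card_fin]
    rw [h1, h2]
    push_cast
    exact three_mul_card_win_fibre_dense_le' c y a b (fun v v' g => hy _ _ (glue3_agreeOff a v v' b) g) (hdense _ hPab)
  · have hnone : ∀ v, ¬ P (glue3 a v b) := fun v h => hPab (hP _ _ (glue3_agreeOff a v _ b) h)
    rw [Finset.filter_false_of_mem fun v _ => by simp [hnone v], card_empty]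
    simp

/-- **The window theorem, any charge**: not reading `M ≥ 42ℓ₀` consecutive bits ⇒ `2^{ℓ₀}·3·#WIN ≤ (2·2^{ℓ₀} + 2)·2ⁿ`. -/
theorem window_le' (n c p M ℓ₀ : ℕ) (hpM : p + M ≤ n) (hM : 42 * ℓ₀ ≤ M)
    (y : Fin (n + 1) → (Fin n → Bool) → Bool) (hy : ∀ u u', AgreeOff n p M u u' → ∀ g, y g u = y g u') :
    (2 : ℝ) ^ ℓ₀ * (3 * ((univ.filter fun u : Fin n → Bool => ringWinU c y u = true).card : ℝ)) ≤
      (2 * (2 : ℝ) ^ ℓ₀ + 2) * (2 : ℝ) ^ n := by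
  classical
  set κ := firstFree y p ℓ₀ with hκ
  have hκ_off : ∀ u u', (∀ g, y g u = y g u') → κ u = κ u' := fun u u' h => firstFree_congr y p ℓ₀ h
  have hblock_off : ∀ (t : Fin 42) (u u' : Fin n → Bool), AgreeOff n (p + t.val * ℓ₀) ℓ₀ u u' → AgreeOff n p M u u' := by
    intro t u u' h i hi
    have ht : (t.val + 1) * ℓ₀ ≤ 42 * ℓ₀ := Nat.mul_le_mul_right _ (by omega)
    rw [Nat.add_mul, one_mul] at ht
    exact h i (by omega)
  set W := (univ.filter fun u : Fin n → Bool => ringWinU c y u = true) with hW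
  have hWsum : (W.card : ℝ) = ∑ k : Option (Fin 42), ((W.filter fun u => κ u = k).card : ℝ) := by
    rw [Finset.card_eq_sum_card_fiberwise (f := κ) (t := univ) (fun _ _ => mem_univ _)]; push_cast; rfl
  have hUsum : ((2 : ℝ) ^ n) = ∑ k : Option (Fin 42), ((univ.filter fun u : Fin n → Bool => κ u = k).card : ℝ) := by
    have := Finset.card_eq_sum_card_fiberwise (f := κ) (s := (univ : Finset (Fin n → Bool))) (t := univ)
      (fun _ _ => mem_univ _)
    rw [card_univ, Fintype.card_fun, Fintype.card_bool, Fintype.card_fin] at this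
    exact_mod_cast this
  have hWk : ∀ k : Option (Fin 42), (W.filter fun u => κ u = k) =
      univ.filter fun u : Fin n → Bool => κ u = k ∧ ringWinU c y u = true := by
    intro k; ext u; simp [hW, and_comm]
  have hclass : ∀ k : Option (Fin 42), (2 : ℝ) ^ ℓ₀ * (3 * ((W.filter fun u => κ u = k).card : ℝ)) ≤
      (2 * (2 : ℝ) ^ ℓ₀ + 2) * ((univ.filter fun u : Fin n → Bool => κ u = k).card : ℝ) := by
    intro k
    rw [hWk k]
    cases k with
    | none =>
      have hd := dense_block_le' n c p M hpM y (fun u => κ u = none)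
        (fun u u' h hu => (hκ_off u u' (hy u u' h)).symm.trans hu)
        hy (fun u hu => card_ge_of_no_free y p ℓ₀ hM u (not_free_of_firstFree_eq_none y p ℓ₀ hu))
      have h0 : (0 : ℝ) ≤ ((univ.filter fun u : Fin n → Bool => κ u = none).card : ℝ) := by positivity
      have h1 : (1 : ℝ) ≤ (2 : ℝ) ^ ℓ₀ := one_le_pow₀ (by norm_num)
      nlinarith
    | some t =>
      have hs := sparse_block_le n c (p + t.val * ℓ₀) ℓ₀ (by
          have ht : (t.val + 1) * ℓ₀ ≤ 42 * ℓ₀ := Nat.mul_le_mul_right _ (by omega)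
          rw [Nat.add_mul, one_mul] at ht; omega)
        y (fun u => κ u = some t)
        (fun u u' h hu => (hκ_off u u' (hy u u' (hblock_off t u u' h))).symm.trans hu)
        (fun u u' h => hy u u' (hblock_off t u u' h))
        (fun u hu g hg1 hg2 => free_of_firstFree_eq_some y p ℓ₀ hu g hg1 hg2)
      have := (Nat.cast_le (α := ℝ)).2 hs
      push_cast at this
      linarith
  rw [hWsum, hUsum, Finset.mul_sum, Finset.mul_sum, Finset.mul_sum]
  exact Finset.sum_le_sum fun k _ => by have := hclass k; linarith

/-! ## The gap law -/

/-- **`gapLaw_window`**: `GapLaw (42·ℓ₀) (2^{ℓ₀} − 2) (3·2^{ℓ₀})` — loss `1/3 − (2/3)·2^{−ℓ₀}`, every charge, every strategy. -/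
theorem gapLaw_window (ℓ₀ : ℕ) (hℓ₀ : 1 ≤ ℓ₀) : GapLaw (42 * ℓ₀) (2 ^ ℓ₀ - 2) (3 * 2 ^ ℓ₀) := by
  intro n c a han y hy
  have hy' : ∀ u u', AgreeOff n a (42 * ℓ₀) u u' → ∀ g, y g u = y g u' := by
    intro u u' h g
    exact hy g u u' fun i hi => h i (by omega)
  have hw := window_le' n c a (42 * ℓ₀) ℓ₀ han le_rfl y hy'
  have h2 : (2 : ℕ) ≤ 2 ^ ℓ₀ := by
    calc (2 : ℕ) = 2 ^ 1 := by norm_num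
      _ ≤ 2 ^ ℓ₀ := Nat.pow_le_pow_right (by norm_num) hℓ₀
  have hsub : 3 * 2 ^ ℓ₀ - (2 ^ ℓ₀ - 2) = 2 * 2 ^ ℓ₀ + 2 := by omega
  rw [hsub]
  have hreal : ((3 * 2 ^ ℓ₀ * (univ.filter fun u : Fin n → Bool => ringWinU c y u = true).card : ℕ) : ℝ) ≤
      (((2 * 2 ^ ℓ₀ + 2) * 2 ^ n : ℕ) : ℝ) := by
    push_cast
    linarith
  exact_mod_cast hreal

end TransferWalk

end Summit.QuantumAdvantage.AdviceFreeQNC0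

end
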